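import Literature.AlgebraicGeometry.Frobenioids.BiratUnitsDiv
import Literature.AlgebraicGeometry.Frobenioids.ModelFrobenioidFunctor
import Literature.AlgebraicGeometry.Frobenioids.BirationalizationFunctor
import Literature.AlgebraicGeometry.Frobenioids.BaseFrobeniusSections
import HarnessLib

/-!
# Frobenioids I, Theorem 5.2 (iv): comparison of a Frobenioid of model type with its model
Frobenioid (statement)

Mochizuki, *The geometry of Frobenioids I: the general theory*, Kyushu J. Math. **62** (2008)
293–400, §5, Theorem 5.2 (iv), kurims text p. 101 (proof pp. 101–103)
[cite: MochizukiFrdI2008, Thm. 5.2(iv) p.101]: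

  "(iv) Suppose that `Φ = Φ`; `B` is the rational function monoid on `D` associated to the
Frobenioid
  `C` [cf. Proposition 4.4, (ii)]; `Div_B : B → Φ^gp` is the natural homomorphism `O^×(−) → Φ^gp`
  [cf. Proposition 4.4, (iii)]; `C` is of model type. Then there exists an equivalence of categories
  `C ⥲ C` (the model Frobenioid of Thm. 5.2 (i)) that is 1-compatible with the functors `C → F_Φ`,
  `C → F_Φ`."

**Rendering.**  The model Frobenioid of `(Φ, B, Div_B)` and its functor to `F_Φ` are seat L1-t2's
`ModelFrobenioid Φ B DivB` / `ModelFrobenioid.toElem` (Thm. 5.2 (i)); "1-compatible" is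
`OneCommutes` ([FrdI] §0).  The rational function monoid (Prop. 4.4 (ii)) is the functor
`A ↦ O^×(A^birat)` on `D` of Prop. 2.2 (ii) applied to `C^birat`, which Prop. 2.2 determines only
"up to isomorphism"; accordingly the hypothesis "`B` is the rational function monoid, `Div_B` the
natural homomorphism" is typed as a STRUCTURE `RationalFunctionMonoidStr F hF B DivB` on a monoid
`B` on `D`: group isomorphisms `B(Base A) ≃ O^×(A^birat)` (the canonical object-level construction
`PreFrobenioid.BiratUnits`, L1-lead RULING C5′) for every `A ∈ Ob(C)`, compatible with `Div_B` and
the divisor map `O^×(A^birat) → Φ^gp(A)` of Prop. 4.4 (i)/(iii), and NATURAL in the sense that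
characterises the functor `O^×(−)` (Prop. 2.2 (ii)(a)(b): along a linear morphism — in particular a
pull-back morphism or a pre-step — `ψ : A → A'`, `B(Base ψ)` is the map `v ↦ u` with
`ψ ∘ u = v ∘ ψ` in `C^birat`, Prop. 1.11 (iv) / Def. 1.3 (iii)(c)); the relation "`ψ ∘ u = v ∘ ψ` in
`C^birat`" is spelled out on fractions (`BiratUnits.Intertwines`).  "Model type" (Def. 4.5 (i) =
pre-model type, Def. 2.7 (iii), + birationally Frobenius-normalized) is seat L1-t3's predicate
(`IsOfBiratFrobeniusNormalizedType`, p405702) together with seat L1-t2's `IsOfPreModelType`; until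
those modules land it enters as an explicit hypothesis binder `isOfModelType : Prop`
(TODO-merge abc-iut-L1-t3 / abc-iut-L1-t2, L1-lead 2026-08-25T19:51Z) — v3 (2026-08-25): merged, the
hypothesis is now `IsOfModelType` = Def. 2.7 (iii) pre-model type ∧ Def. 4.5 (i) birationally
Frobenius-normalized over the birationalization `C^birat` of `Birationalization*.lean`.  Seat
L1-t2's
parametric shape `PreFrobenioid.ModelTypeEquivalence F I B DivB` (staged
ModelFrobenioidProperties.lean) has
the
same conclusion with `B, Div_B` free; `Thm52iv` is that conclusion for the `B` pinned to
`O^×(−^birat)` as printed.  Statement only; the proof (F_P-paths, Rmk. 2.7.2, Thm. 5.1) is seat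
abc-iut-L6-t8's F-D2.
-/

namespace Literature.AlgebraicGeometry.Frobenioids

open CategoryTheory Opposite

universe w v v' u u'

namespace PreFrobenioid

variable {D : Type u} [Category.{v} D] {Φ : Dᵒᵖ ⥤ CommMonCat.{w}}
  {C : Type u'} [Category.{v'} C] {F : C ⥤ ElemFrobenioid Φ}

namespace BiratUnits

variable (hF : IsFrobenioid F)

/-- "`ψ ∘ u = v ∘ ψ` in `C^birat`" for a morphism `ψ : A → A'` of `C` and rational functions
`u ∈ O^×(A^birat)`, `v ∈ O^×(A'^birat)`, spelled out on fractions: `u = [(α, φ)]`, `v = [(β, χ)]`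
and,
for some co-angular pre-step `κ` and some morphism `l` (the two legs of a composition square of
`C^birat`, Prop. 4.4 (i) p. 84 — `l` is a pull-back morphism, NOT a pre-step, when `ψ` is one),
`l ≫ β = κ ≫ α ≫ ψ` and `l ≫ χ = κ ≫ φ ≫ ψ` (both sides of "`ψ ∘ u = v ∘ ψ`" then equal
`[(κ ≫ α, κ ≫ φ ≫ ψ)]` in `Hom^birat(A, A')`).  This is the relation "`β ∘ φ = φ ∘ α`" by which
Def. 1.3 (iii)(c) (pre-steps) and Prop. 1.11 (iv) (linear morphisms) transport units, i.e. by which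
Prop. 2.2 (ii)(a)(b) defines the functor `O^×(−)`.  (v2, 2026-08-25, author's correction: v1 also
required `l` to be a pre-step, which is only possible when `Base ψ` is an isomorphism and made the
relation — hence `RationalFunctionMonoidStr` — unsatisfiable along genuine pull-back morphisms.)
[cite: MochizukiFrdI2008, Prop. 2.2(ii) p.45] -/
def Intertwines {A A' : C} (ψ : A ⟶ A') (u : BiratUnits F hF A) (v : BiratUnits F hF A') : Prop :=
  ∃ (p : RatFrac F A) (q : RatFrac F A') (E : C) (κ : E ⟶ p.src) (l : E ⟶ q.src),
    mk hF p = u ∧ mk hF q = v ∧ IsCoAngularPreStep F κ ∧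
      l ≫ q.den = κ ≫ p.den ≫ ψ ∧ l ≫ q.num = κ ≫ p.num ≫ ψ

end BiratUnits

variable (F) in
/-- "`B` is the rational function monoid on `D` associated to the Frobenioid `C` [Prop. 4.4 (ii)]
and
`Div_B : B → Φ^gp` is the natural homomorphism `O^×(−) → Φ^gp` [Prop. 4.4 (iii)]" — as a structure
on
a monoid `B` on `D` with `Div_B : B ⟶ Φ^gp`: isomorphisms `B(Base A) ≃ O^×(A^birat)` for all
`A ∈ Ob(C)`, compatible with the divisor maps, and natural along linear morphisms of `C` in the
sense
of Prop. 2.2 (ii)(a)(b) (which determines `O^×(−)` on `D` up to isomorphism, Prop. 2.2 (ii)).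
[cite: MochizukiFrdI2008, Prop. 4.4(ii) p.83] -/
structure RationalFunctionMonoidStr (hF : IsFrobenioid F) (B : Dᵒᵖ ⥤ CommMonCat.{w})
    (DivB : B ⟶ monoidGp Φ) : Type (max u' v' w) where
  /-- `B(Base A) ≅ O^×(A^birat)` -/
  iso : ∀ A : C, B.obj (op (baseObj F A)) ≃* BiratUnits F hF A
  /-- `Div_B` corresponds to the divisor map `O^×(A^birat) → Φ^gp(A)` of Prop. 4.4 (i)/(iii) -/
  div_iso : ∀ (A : C) (b : B.obj (op (baseObj F A))),
    BiratUnits.divHom hF A (iso A b) = (DivB.app (op (baseObj F A))).hom b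
  /-- naturality along linear `ψ : A → A'`: `B(Base ψ)(v)` is the `u` with `ψ ∘ u = v ∘ ψ` in
`C^birat` -/
  natural : ∀ ⦃A A' : C⦄ (ψ : A ⟶ A'), IsLinear F ψ → ∀ b' : B.obj (op (baseObj F A')),
    BiratUnits.Intertwines hF ψ (iso A ((B.map (Base F ψ).op).hom b')) (iso A' b')

variable (F) in
/-- **Definition 4.5 (i)** (FrdI p. 86): an object `A` is *birationally Frobenius-normalized* if its
image `A^birat` in `C^birat` is Frobenius-normalized (Def. 1.2 (iv): `φ ≫ α^{deg_Fr φ} = α ≫ φ` for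
base-identity endomorphisms `φ` and `α ∈ O^▷(A^birat)`) — here for THE birationalization
`Birat F hF hsq` with its structure functor `C^birat → F_{Φ^gp}` (`BirationalizationFunctor.lean`;
`hsq` = Prop. 1.11 (vii)).  (Seat L1-t3's `IsBiratFrobeniusNormalizedObj B A` is the same notion
over an
abstract birationalization datum `B`; TODO-bridge via seat L6-t6's `BiratData` instance.)
[cite: MochizukiFrdI2008, Def. 4.5(i) p.86] -/
def IsBiratFrobeniusNormalized (hF : IsFrobenioid F) (hsq : HasBiratSquares F) (A : C) : Prop :=
  IsFrobeniusNormalized (Birat.toElemGp hF hsq) ((toBirat F hF hsq).obj A)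

variable (F) in
/-- **Definition 4.5 (i)** (FrdI p. 86): "If `C` is of pre-model and birationally
Frobenius-normalized
type, then we shall say that `C` is *of model type*" — pre-model type is Def. 2.7 (iii)
(`IsOfPreModelType`, seat L1-t2: `C` admits a base-Frobenius pair). [cite: MochizukiFrdI2008, Def.
4.5(i) p.86] -/
def IsOfModelType (hF : IsFrobenioid F) (hsq : HasBiratSquares F) : Prop :=
  IsOfPreModelType F ∧ ∀ A : C, IsBiratFrobeniusNormalized F hF hsq A

variable (F) in
/-- **Theorem 5.2 (iv)** (FrdI p. 101), statement: for a Frobenioid `C → F_Φ` of model type, with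
`B` the rational function monoid of `C` and `Div_B : B → Φ^gp` the natural homomorphism, "there
exists an equivalence of categories `C ⥲` (the model Frobenioid of `(Φ, B, Div_B)`) that is
1-compatible with the functors `C → F_Φ`, (model) `→ F_Φ`".  v3: the hypothesis is the predicate
`IsOfModelType` of Def. 4.5 (i) over the birationalization `C^birat` (replacing the opaque binder of
v1/v2; `hsq` = Prop. 1.11 (vii)) TOGETHER WITH isotropic type: the author's *Comments on FrdI*
(January 2024), item (27), replace the first sentence of Thm. 5.2 (iv) by "Suppose that `C` is of
isotropic and model type; … `B` is the rational function monoid on `D` associated to the Frobenioid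
`C`
[cf. Proposition 4.4, (ii), as amended by item (29)]; `Div_B : B → Φ^gp` is the natural homomorphism
`O^×(−) → Φ^gp`" — per L1-lead R42 (2026-08-25) the binder is typed in this 2024 form (the printed
2008 sentence lacks "isotropic"; locator of record remains kurims p. 101).
[cite: MochizukiFrdI2008, Thm. 5.2(iv) p.101] -/
def Thm52iv (hF : IsFrobenioid F) (hsq : HasBiratSquares F) : Prop :=
  IsOfModelType F hF hsq ∧ IsOfIsotropicType F →
    ∀ (B : Dᵒᵖ ⥤ CommMonCat.{w}) (DivB : B ⟶ monoidGp Φ)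
      (_ : RationalFunctionMonoidStr F hF B DivB),
      ∃ E : C ⥤ ModelFrobenioid Φ B DivB, E.IsEquivalence ∧
        OneCommutes E (ModelFrobenioid.toElem Φ B DivB) F (𝟭 (ElemFrobenioid Φ))

end PreFrobenioid

end Literature.AlgebraicGeometry.Frobenioids
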